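import Literature.Topology.Immersions.GenericImmersionPerturbation
import Literature.Topology.Immersions.HirschNormalBundleIso
import Literature.Topology.Immersions.HirschImmersionTwisted
import HarnessLib

/-!
# A generic immersion with prescribed normal bundle (Hirsch + general position)

Topic `Literature/Topology/Immersions`. Capstone of the general-position engine for Kirby,
*The Topology of 4-Manifolds* (1989), Ch. VI (proof of Thm. VIII.1(A): *"immerse `M₁` in `R⁶`
… with normal bundle `ν`, `χ(ν) = χ` …"* and its triple-point calculus, which presupposes a
GENERIC immersion): for a compact `n`-manifold `M` and a rank-`k` bundle `E = E(P)` in `M × ℝᵐ`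
with `TM ⊕ E` framed (`k ≥ 1`, `4n < 3(n + k)`), there is a `C^∞` immersion
`g : M → ℝⁿ⁺ᵏ` **in general position** (transverse double and triple points, no quadruple
points) **whose normal bundle is isomorphic to `E`** (`exists_genericImmersion_isIso_normal`):
Hirsch's theorem (`ProjBundle.exists_immersion_of_frame`) gives an immersion `g₀` with
`E ≅ ν_{g₀}` (`ProjBundle.isIso_normal_of_hirschData`); the generic perturbation `g` of `g₀`
(`exists_genericImmersion_perturbation`) has `‖P^ν_{g₀} - P^ν_g‖ < 1`, so `ν_{g₀} ≅ ν_g`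
(`ProjBundle.isIso_proj_of_norm_sub_lt_one`); isomorphisms compose (`ProjBundle.IsIso.comp`).

Everything here is proved; no definitions, no named facts.

## References

* R. C. Kirby, *The Topology of 4-Manifolds*, LNM 1374 (1989), Ch. VI, Ch. VIII proof of
  Thm. 1(A). [Kirby1989]
* M. W. Hirsch, *Immersions of manifolds*, Trans. AMS 93 (1959), Thm. 6.3; *Differential
  Topology* (1976), Ch. 3 §2. [Hirsch1959] [HirschDT1976]
-/

open scoped Manifold ContDiff Topology
open Set Function Module Bundle

noncomputable section

namespace Literature.Topology.Immersions

/-- Local notation: `𝔼 n` is the model Euclidean space `EuclideanSpace ℝ (Fin n)`. -/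
local notation "𝔼 " n:arg => EuclideanSpace ℝ (Fin n)

namespace ProjBundle

variable {n m m' m'' k : ℕ} {M : Type*} [TopologicalSpace M] [ChartedSpace (𝔼 n) M]

/-- **Bundle isomorphisms compose.** [folklore] -/
theorem IsIso.comp {P : ProjBundle n m k M} {P' : ProjBundle n m' k M} {P'' : ProjBundle n m'' k M}
    {Φ : M → 𝔼 m →L[ℝ] 𝔼 m'} {Ψ : M → 𝔼 m' →L[ℝ] 𝔼 m''}
    (hΦ : IsIso P P' Φ) (hΨ : IsIso P' P'' Ψ) : IsIso P P'' fun x => (Ψ x).comp (Φ x) :=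
  { contMDiff := hΨ.contMDiff.clm_comp hΦ.contMDiff
    mapsTo := fun x v hv => hΨ.mapsTo x _ (hΦ.mapsTo x v hv)
    injOn := fun x v hv w hw h => hΦ.injOn x hv hw (hΨ.injOn x (hΦ.mapsTo x v hv) (hΦ.mapsTo x w hw) h) }

end ProjBundle

variable {n m k : ℕ}

/-- **A generic immersion with prescribed normal bundle.** Let `M` be a compact `n`-manifold
(Hausdorff, second countable, in `Type`), `E = E(P)` a rank-`k` bundle in `M × ℝᵐ` (`k ≥ 1`,
`4n < 3(n + k)`) and `s` a framing of `TM ⊕ E` (as in `ProjBundle.exists_immersion_of_frame`).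
Then there are a `C^∞` immersion `g : M → ℝⁿ⁺ᵏ` and a bundle isomorphism `Φ` from `E` onto the
normal bundle of `g` such that all double points of `g` are transverse, all triple points are
transverse, and `g` has no quadruple point. [cite: Kirby1989, Ch. VIII proof of Thm. 1(A); HirschDT1976, Ch. 3 §2 Ex. 1–2] -/
theorem exists_genericImmersion_isIso_normal (hk : 1 ≤ k)
    (hdim : n + (n + (n + n)) < (n + k) + ((n + k) + (n + k)))
    {M : Type} [TopologicalSpace M] [T2Space M] [SecondCountableTopology M] [CompactSpace M]
    [ChartedSpace (𝔼 n) M] [IsManifold (𝓡 n) ∞ M]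
    (P : ProjBundle n m k M) (s : Fin (n + k) → M → 𝔼 n × 𝔼 m)
    (hs1 : ∀ i, Continuous fun x => (TotalSpace.mk' (𝔼 n) x (s i x).1 : TangentBundle (𝓡 n) M))
    (hs2 : ∀ i, Continuous fun x => (s i x).2)
    (hs3 : ∀ i x, P.proj x (s i x).2 = (s i x).2)
    (hli : ∀ x, LinearIndependent ℝ fun i => s i x) :
    ∃ (g : M → 𝔼 (n + k)) (hg : ContMDiff (𝓡 n) (𝓡 (n + k)) ∞ g)
      (himm : ∀ x, Injective (mfderiv (𝓡 n) (𝓡 (n + k)) g x)) (Φ : M → 𝔼 m →L[ℝ] 𝔼 (n + k)),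
      ProjBundle.IsIso P (ProjBundle.normal (Nat.add_comm k n) g hg himm) Φ ∧
      (∀ x y : M, x ≠ y → g x = g y →
        ∀ w : 𝔼 (n + k), ∃ ζ : 𝔼 n × 𝔼 n, ediff n (n + k) g x ζ.1 - ediff n (n + k) g y ζ.2 = w) ∧
      (∀ x y z : M, x ≠ y → y ≠ z → x ≠ z → g x = g y → g y = g z →
        ∀ w : 𝔼 (n + k) × 𝔼 (n + k), ∃ ζ : 𝔼 n × 𝔼 n × 𝔼 n,
          (ediff n (n + k) g x ζ.1 - ediff n (n + k) g y ζ.2.1,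
            ediff n (n + k) g y ζ.2.1 - ediff n (n + k) g z ζ.2.2) = w) ∧
      (∀ a b c d : M, a ≠ b → a ≠ c → a ≠ d → b ≠ c → b ≠ d → c ≠ d →
        g a = g b → g b = g c → g c ≠ g d) := by
  -- Hirsch: an immersion `g₀ = F(·, 0)` with `E ≅ ν_{g₀}`
  obtain ⟨F, hF, hg₀, himm₀, hdg, hker⟩ := P.exists_immersion_of_frame hk s hs1 hs2 hs3 hli
  have hiso₀ := P.isIso_normal_of_hirschData (Nat.add_comm k n) hF hg₀ himm₀ hdg hker
  -- generic perturbation `g = g₀ + Λ ∘ ρ` with nearby normal projections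
  obtain ⟨K, ρ, Λ, hρs, -, -, hhom, h2, h3, h4⟩ :=
    exists_genericImmersion_perturbation hdim hg₀ himm₀ one_pos
  let g : M → 𝔼 (n + k) := fun z => F (z, 0) + Λ (ρ z)
  have hg : ContMDiff (𝓡 n) (𝓡 (n + k)) ∞ g := hg₀.add (Λ.contDiff.comp_contMDiff hρs)
  have h1 := hhom 1 (by simp)
  have e1 : (1 : ℝ) • Λ = Λ := one_smul ℝ Λ
  rw [e1] at h1
  have himm : ∀ x, Injective (mfderiv (𝓡 n) (𝓡 (n + k)) g x) := fun x => (h1 x).1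
  have hclose : ∀ x, ‖ProjBundle.normalProj n (fun y => F (y, 0)) x - ProjBundle.normalProj n g x‖ < 1 :=
    fun x => (h1 x).2
  -- `ν_{g₀} ≅ ν_g`
  have hiso₁ := ProjBundle.isIso_proj_of_norm_sub_lt_one
    (ProjBundle.normal (Nat.add_comm k n) (fun y => F (y, 0)) hg₀ himm₀)
    (ProjBundle.normal (Nat.add_comm k n) g hg himm) hclose
  refine ⟨g, hg, himm, _, hiso₀.comp hiso₁, h2, h3, h4⟩

end Literature.Topology.Immersions
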